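import Summits.Ventures.PercRepro.Night2LocalD2R14SixOneD
import Summits.Ventures.PercRepro.Night2LocalD2R14LargeCol

/-!
# PercRepro — the six-element columns of R1₄ without a far preimage, part A: the general spread bound (night-2, gen 16)

At a six-element shadow set `S` of the coloop cell the spread part is at most `b · (3/35)/(|G ∖ S| + 1)`, where `b` is
the number of points `x ∈ S ∖ {y}` whose basis `S ∖ {x, y}` is a member (`r14Spread_le_six`): each spreading basis
contributes `(σ⁺ − 3/5)⁺/|cl B ∖ B| ≤ (24/35 − 3/5)/(|G ∖ S| + 1)` (Night2LocalD2R14SixOneB).  With two covering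
preimages `S ∖ {z₁}`, `S ∖ {z₂}` the bases `S ∖ {zᵢ, y}` have rank `3`, so `b ≤ 3` (`card_basisPts_le_three_of_two_covPre`);
there are at most two such covering preimages (`card_r14CovPre_le_two_six`, the `|S| ≥ 6` form of gen 16's bound).
-/

namespace PercRepro.Shadow

open Finset PerFlat ThmH

variable {α : Type*} [DecidableEq α] {M : Matroid α} [M.Finite]

open scoped Classical in
/-- **The spread part at `|S| = 6`**: at most `#basisPts · (3/35)/(|G ∖ S| + 1)`. -/
theorem r14Spread_le_six {G : Finset α} (hG : G ∈ flatsQ M (4 + 1)) {y : α} (hyG : y ∈ G)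
    (hyc : y ∉ clF M (G.erase y)) (hP : ∀ z ∈ G.erase y, 4 ≤ rkN M ((G.erase y).erase z)) {S : Finset α}
    (hS : S ∈ shadowAt M (4 + 2) 4 (Uq M (4 + 2) 4) G) (h6 : S.card = 6) :
    r14Spread M G S ≤ (((S.erase y).filter (fun x => (S.erase y).erase x ∈ membersIn M (Uq M (4 + 2) 4) G)).card : ℚ) * ((3 / 35) / (((G \ S).card : ℚ) + 1)) := by
  have hSG : S ⊆ G := subset_of_mem_shadowAt hS
  set c : ℚ := (3 / 35) / (((G \ S).card : ℚ) + 1) with hcdef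
  have hc0 : 0 ≤ c := by positivity
  -- termwise: a basis `B` with `S = insert x (B ∪ {y})` contributes `≤ c`
  have hterm : ∀ B ∈ (membersIn M (Uq M (4 + 2) 4) G).filter (fun B => (G \ clF M B).card = 1 ∧ ¬ 5 ≤ B.card),
      ∑ x ∈ clF M B \ B, (if S = insert x (B ∪ (G \ clF M B)) then
        (2 / 5 - r14Keep M G B) / ((clF M B \ B).card : ℚ) else 0) ≤
      (if ∃ x ∈ S, S = insert x (B ∪ (G \ clF M B)) then c else 0) := by
    intro B hB
    rw [Finset.mem_filter] at hB
    obtain ⟨hBm, hm1, hB5⟩ := hB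
    have hpt : ∀ x ∈ clF M B \ B, (if S = insert x (B ∪ (G \ clF M B)) then
        (2 / 5 - r14Keep M G B) / ((clF M B \ B).card : ℚ) else 0) ≤
        (if x ∈ S ∧ S = insert x (B ∪ (G \ clF M B)) then c else 0) := by
      intro x hx
      by_cases hSx : S = insert x (B ∪ (G \ clF M B))
      · obtain ⟨hGy, hyB, hxB, hxy, hB4, hSx'⟩ := basis_facts_of_six hG hyG hyc hP h6 hBm hm1 hx hSx
        have hxS : x ∈ S := by rw [hSx']; exact Finset.mem_insert_self _ _
        rw [if_pos hSx, if_pos ⟨hxS, hSx⟩]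
        have hk := two_fifths_sub_r14Keep_le (M := M) G B
        have hs := r14Sigma_le (M := M) G B
        rw [hB4] at hs
        have hcard := card_sdiff_ge_of_basis hG hyG hyc hSG hBm hxB hxy hyB hSx'
        have hcpos : (0 : ℚ) < ((clF M B \ B).card : ℚ) := by
          have : 0 < (clF M B \ B).card := by omega
          exact_mod_cast this
        have hnum : 2 / 5 - r14Keep M G B ≤ 3 / 35 := by
          have : max 0 (r14Sigma M G B - 3 / 5) ≤ 3 / 35 := max_le (by norm_num) (by linarith)
          linarith
        have hnum0 : 0 ≤ 2 / 5 - r14Keep M G B := by linarith [r14Keep_le (M := M) G B]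
        rw [hcdef, div_le_div_iff₀ hcpos (by positivity)]
        have hcq : ((G \ S).card : ℚ) + 1 ≤ ((clF M B \ B).card : ℚ) := by exact_mod_cast hcard
        nlinarith
      · rw [if_neg hSx, if_neg (fun h => hSx h.2)]
    calc ∑ x ∈ clF M B \ B, (if S = insert x (B ∪ (G \ clF M B)) then
          (2 / 5 - r14Keep M G B) / ((clF M B \ B).card : ℚ) else 0)
        ≤ ∑ x ∈ clF M B \ B, (if x ∈ S ∧ S = insert x (B ∪ (G \ clF M B)) then c else 0) :=
          Finset.sum_le_sum hpt
      _ ≤ (if ∃ x ∈ S, S = insert x (B ∪ (G \ clF M B)) then c else 0) := by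
          rw [← Finset.sum_filter]
          have hle : ((clF M B \ B).filter (fun x => x ∈ S ∧ S = insert x (B ∪ (G \ clF M B)))).card ≤ 1 := by
            rw [Finset.card_le_one]
            intro x hx x' hx'
            rw [Finset.mem_filter] at hx hx'
            have h2 : x' ∈ insert x (B ∪ (G \ clF M B)) := by rw [← hx.2.2, hx'.2.2]; exact Finset.mem_insert_self _ _
            rw [Finset.mem_insert] at h2
            rcases h2 with h | h
            · exact h.symm
            · exfalso
              rw [Finset.mem_union] at h
              rcases h with h | h
              · exact (Finset.mem_sdiff.1 hx'.1).2 h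
              · exact (Finset.mem_sdiff.1 h).2 (Finset.mem_sdiff.1 hx'.1).1
          rw [Finset.sum_const, nsmul_eq_mul]
          split_ifs with hex
          · have : (((clF M B \ B).filter (fun x => x ∈ S ∧ S = insert x (B ∪ (G \ clF M B)))).card : ℚ) ≤ 1 := by
              exact_mod_cast hle
            nlinarith
          · have hempty : (clF M B \ B).filter (fun x => x ∈ S ∧ S = insert x (B ∪ (G \ clF M B))) = ∅ := by
              rw [Finset.filter_eq_empty_iff]
              intro x _ hx
              exact hex ⟨x, hx.1, hx.2⟩
            rw [hempty, Finset.card_empty]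
            simp
  unfold r14Spread
  calc ∑ B ∈ (membersIn M (Uq M (4 + 2) 4) G).filter (fun B => (G \ clF M B).card = 1 ∧ ¬ 5 ≤ B.card),
        ∑ x ∈ clF M B \ B, (if S = insert x (B ∪ (G \ clF M B)) then
          (2 / 5 - r14Keep M G B) / ((clF M B \ B).card : ℚ) else 0)
      ≤ ∑ B ∈ (membersIn M (Uq M (4 + 2) 4) G).filter (fun B => (G \ clF M B).card = 1 ∧ ¬ 5 ≤ B.card),
        (if ∃ x ∈ S, S = insert x (B ∪ (G \ clF M B)) then c else 0) := Finset.sum_le_sum hterm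
    _ ≤ (((S.erase y).filter (fun x => (S.erase y).erase x ∈ membersIn M (Uq M (4 + 2) 4) G)).card : ℚ) * c := by
        rw [← Finset.sum_filter, Finset.sum_const, nsmul_eq_mul]
        -- the qualifying bases inject into the basis points via `B ↦ x`
        have hle : (((membersIn M (Uq M (4 + 2) 4) G).filter (fun B => (G \ clF M B).card = 1 ∧ ¬ 5 ≤ B.card)).filter
            (fun B => ∃ x ∈ S, S = insert x (B ∪ (G \ clF M B)))).card ≤ ((S.erase y).filter (fun x => (S.erase y).erase x ∈ membersIn M (Uq M (4 + 2) 4) G)).card := by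
          -- the map `B ↦ S ∖ (B ∪ {y})` is injective with values the singletons `{x}`, `x ∈ basisPts`
          have key : ∀ B ∈ ((membersIn M (Uq M (4 + 2) 4) G).filter (fun B => (G \ clF M B).card = 1 ∧ ¬ 5 ≤ B.card)).filter
              (fun B => ∃ x ∈ S, S = insert x (B ∪ (G \ clF M B))),
              ∃ x ∈ (S.erase y).filter (fun x => (S.erase y).erase x ∈ membersIn M (Uq M (4 + 2) 4) G), S \ (B ∪ {y}) = {x} ∧ B = (S.erase y).erase x := by
            intro B hB
            rw [Finset.mem_filter, Finset.mem_filter] at hB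
            obtain ⟨⟨hBm, hm1, hB5⟩, x, hxS, hSx⟩ := hB
            have hGy : G \ clF M B = {y} := by
              have hBU : B ∈ Uq M (4 + 2) 4 := (mem_membersIn.1 hBm).1
              have hBG : B ⊆ G := (subset_clF hBU).trans (mem_membersIn.1 hBm).2
              have hyB : y ∉ B := by
                intro hyB
                have := two_le_card_sdiff_clF_of_mem_coloop hG hyG hyc hP hBm hyB
                omega
              exact sdiff_clF_eq_singleton_of_subset_erase hG hyG hyc hBm
                (fun e he => Finset.mem_erase.2 ⟨fun h => hyB (h ▸ he), hBG he⟩)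
            rw [hGy] at hSx
            have hyB : y ∉ B := by
              intro hyB
              have := two_le_card_sdiff_clF_of_mem_coloop hG hyG hyc hP hBm hyB
              rw [hGy, Finset.card_singleton] at this
              omega
            have hxB : x ∉ B := by
              intro hxB
              have h1 : S = B ∪ {y} := by
                rw [hSx]
                exact Finset.insert_eq_of_mem (Finset.mem_union_left _ hxB)
              have := Finset.card_union_le B {y}
              rw [← h1, Finset.card_singleton] at this
              have h4 := rkN_le_card_fin (M := M) B
              rw [rkN_eq_of_mem_Uq (mem_membersIn.1 hBm).1] at h4
              -- `|B| ≤ 4` from `¬ 5 ≤ |B|`, so `|S| ≤ 5`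
              omega
            have hxy : x ≠ y := by
              intro h
              subst h
              have h1 : S = insert x B := by rw [hSx]; ext e; simp
              have := Finset.card_insert_le x B
              rw [← h1] at this
              omega
            have hBeq : B = (S.erase y).erase x := by
              ext e
              rw [Finset.mem_erase, Finset.mem_erase, hSx, Finset.mem_insert, Finset.mem_union, Finset.mem_singleton]
              constructor
              · intro he
                exact ⟨fun h => hxB (h ▸ he), fun h => hyB (h ▸ he), Or.inr (Or.inl he)⟩
              · rintro ⟨hex, hey, h⟩
                rcases h with h | h | h
                · exact absurd h hex
                · exact h
                · exact absurd h hey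
            refine ⟨x, ?_, ?_, hBeq⟩
            · rw [Finset.mem_filter, Finset.mem_erase, ← hBeq]
              exact ⟨⟨hxy, hxS⟩, hBm⟩
            · rw [hSx, Finset.insert_sdiff_of_notMem _ (by
                rw [Finset.mem_union, Finset.mem_singleton, not_or]; exact ⟨hxB, hxy⟩), Finset.sdiff_self,
                Finset.insert_empty]
          have hmaps : ∀ B ∈ ((membersIn M (Uq M (4 + 2) 4) G).filter (fun B => (G \ clF M B).card = 1 ∧ ¬ 5 ≤ B.card)).filter
              (fun B => ∃ x ∈ S, S = insert x (B ∪ (G \ clF M B))), S \ (B ∪ {y}) ∈ Finset.powersetCard 1 ((S.erase y).filter (fun x => (S.erase y).erase x ∈ membersIn M (Uq M (4 + 2) 4) G)) := by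
            intro B hB
            obtain ⟨x, hx, hxeq, -⟩ := key B hB
            rw [Finset.mem_powersetCard, hxeq]
            exact ⟨Finset.singleton_subset_iff.2 hx, Finset.card_singleton _⟩
          have hinj : Set.InjOn (fun B => S \ (B ∪ {y}))
              ((((membersIn M (Uq M (4 + 2) 4) G).filter (fun B => (G \ clF M B).card = 1 ∧ ¬ 5 ≤ B.card)).filter
                (fun B => ∃ x ∈ S, S = insert x (B ∪ (G \ clF M B)))) : Set (Finset α)) := by
            intro B hB B' hB' h
            obtain ⟨x, -, hxeq, hBeq⟩ := key B (Finset.mem_coe.1 hB)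
            obtain ⟨x', -, hxeq', hBeq'⟩ := key B' (Finset.mem_coe.1 hB')
            have h' : S \ (B ∪ {y}) = S \ (B' ∪ {y}) := h
            rw [hxeq, hxeq'] at h'
            have hxx : x = x' := Finset.singleton_inj.1 h'
            rw [hBeq, hBeq', hxx]
          have h1 := Finset.card_le_card_of_injOn (fun B => S \ (B ∪ {y})) hmaps hinj
          rw [Finset.card_powersetCard, Nat.choose_one_right] at h1
          exact h1
        have : ((((membersIn M (Uq M (4 + 2) 4) G).filter (fun B => (G \ clF M B).card = 1 ∧ ¬ 5 ≤ B.card)).filter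
            (fun B => ∃ x ∈ S, S = insert x (B ∪ (G \ clF M B)))).card : ℚ) ≤ (((S.erase y).filter (fun x => (S.erase y).erase x ∈ membersIn M (Uq M (4 + 2) 4) G)).card : ℚ) := by
          exact_mod_cast hle
        nlinarith

open scoped Classical in
/-- With two covering preimages `S ∖ {z₁}`, `S ∖ {z₂}` (`|G ∖ cl B| ≥ 2`) the bases `S ∖ {zᵢ, y}` have rank `3`, so at
most three points of `S ∖ {y}` carry a member basis. -/
theorem card_basisPts_le_three_of_two_covPre {G : Finset α} (hG : G ∈ flatsQ M (4 + 1)) {y : α} (hyG : y ∈ G)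
    (hyc : y ∉ clF M (G.erase y)) {S : Finset α} (hS : S ∈ shadowAt M (4 + 2) 4 (Uq M (4 + 2) 4) G)
    (h6 : S.card = 6) {B₁ B₂ : Finset α} (h₁ : B₁ ∈ r14CovPre M G S) (h₂ : B₂ ∈ r14CovPre M G S) (hne : B₁ ≠ B₂) :
    ((S.erase y).filter (fun x => (S.erase y).erase x ∈ membersIn M (Uq M (4 + 2) 4) G)).card ≤ 3 := by
  have hGg : G ⊆ gr M := (mem_flatsQ.1 hG).1
  have hSG : S ⊆ G := subset_of_mem_shadowAt hS
  have hyS : y ∈ S := mem_of_mem_shadowAt_of_coloop (by rw [rkN_erase_eq_of_coloop hG hyG hyc]) hS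
  obtain ⟨z₁, hz₁S, hz₁y, rfl, hz₁, -⟩ := exists_coloop_of_mem_r14CovPre hG hyG hyc h₁
  obtain ⟨z₂, hz₂S, hz₂y, rfl, hz₂, -⟩ := exists_coloop_of_mem_r14CovPre hG hyG hyc h₂
  have hz₁₂ : z₁ ≠ z₂ := fun h => hne (by rw [h])
  -- a coloop `z` of `S` is not a basis point: `S ∖ {z, y}` has rank `3`
  have hnot : ∀ z ∈ S, z ≠ y → z ∉ clF M (S.erase z) → z ∉ (S.erase y).filter (fun x => (S.erase y).erase x ∈ membersIn M (Uq M (4 + 2) 4) G) := by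
    intro z hzS hzy hz hmem
    rw [Finset.mem_filter] at hmem
    have hU : (S.erase y).erase z ∈ Uq M (4 + 2) 4 := (mem_membersIn.1 hmem.2).1
    have hr4 := rkN_eq_of_mem_Uq hU
    -- `S = insert y (insert z ((S.erase y).erase z))` has rank `ρ((S ∖ {y, z})) + 2 = 6`, but `ρ(S) = 5`
    have hsub : (S.erase y).erase z ⊆ S.erase z := by
      intro e he
      rw [Finset.mem_erase, Finset.mem_erase] at he
      exact Finset.mem_erase.2 ⟨he.1, he.2.2⟩
    have h1 := rkN_insert_coloop_eq (hSG.trans hGg) hzS hz hsub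
    have hsub2 : insert z ((S.erase y).erase z) ⊆ G.erase y := by
      intro e he
      rw [Finset.mem_insert] at he
      rcases he with rfl | he
      · exact Finset.mem_erase.2 ⟨hzy, hSG hzS⟩
      · rw [Finset.mem_erase, Finset.mem_erase] at he
        exact Finset.mem_erase.2 ⟨he.2.1, hSG he.2.2⟩
    have h2 := rkN_insert_coloop_eq hGg hyG hyc hsub2
    have hSeq : insert y (insert z ((S.erase y).erase z)) = S := by
      rw [Finset.insert_erase (Finset.mem_erase.2 ⟨hzy, hzS⟩), Finset.insert_erase hyS]
    rw [hSeq, rkN_eq_five_of_mem_shadowAt hS] at h2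
    omega
  have hsub : (S.erase y).filter (fun x => (S.erase y).erase x ∈ membersIn M (Uq M (4 + 2) 4) G) ⊆ (S.erase y) \ {z₁, z₂} := by
    intro x hx
    have hxS : x ∈ S.erase y := Finset.mem_of_mem_filter x hx
    rw [Finset.mem_sdiff, Finset.mem_insert, Finset.mem_singleton, not_or]
    refine ⟨hxS, fun h => hnot z₁ hz₁S hz₁y hz₁ (h ▸ hx), fun h => hnot z₂ hz₂S hz₂y hz₂ (h ▸ hx)⟩
  have h1 := Finset.card_le_card hsub
  have h2 : (({z₁, z₂} : Finset α)).card = 2 := Finset.card_pair hz₁₂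
  have h3 : ({z₁, z₂} : Finset α) ⊆ S.erase y := by
    intro e he
    rw [Finset.mem_insert, Finset.mem_singleton] at he
    rcases he with rfl | rfl
    · exact Finset.mem_erase.2 ⟨hz₁y, hz₁S⟩
    · exact Finset.mem_erase.2 ⟨hz₂y, hz₂S⟩
  have h4 := Finset.card_sdiff_add_card_eq_card h3
  rw [Finset.card_erase_of_mem hyS, h6] at h4
  omega

open scoped Classical in
/-- At most two covering preimages with `|G ∖ cl B| ≥ 2` at a shadow set with `|S| ≥ 6` (simple matroid). -/
theorem card_r14CovPre_le_two_six {G : Finset α} (hG : G ∈ flatsQ M (4 + 1))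
    (hsimple : ∀ e ∈ gr M, ∀ f ∈ gr M, e ≠ f → rkN M {e, f} = 2) {y : α} (hyG : y ∈ G)
    (hyc : y ∉ clF M (G.erase y)) {S : Finset α} (hS : S ∈ shadowAt M (4 + 2) 4 (Uq M (4 + 2) 4) G)
    (h6 : 6 ≤ S.card) : (r14CovPre M G S).card ≤ 2 := by
  have hGg : G ⊆ gr M := (mem_flatsQ.1 hG).1
  have hSG : S ⊆ G := subset_of_mem_shadowAt hS
  have hyS : y ∈ S := mem_of_mem_shadowAt_of_coloop (by rw [rkN_erase_eq_of_coloop hG hyG hyc]) hS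
  by_contra hcon
  push Not at hcon
  rw [Finset.two_lt_card_iff] at hcon
  obtain ⟨B₁, B₂, B₃, hB₁, hB₂, hB₃, h₁₂, h₁₃, h₂₃⟩ := hcon
  obtain ⟨z₁, hz₁S, hz₁y, rfl, hz₁, -⟩ := exists_coloop_of_mem_r14CovPre hG hyG hyc hB₁
  obtain ⟨z₂, hz₂S, hz₂y, rfl, hz₂, -⟩ := exists_coloop_of_mem_r14CovPre hG hyG hyc hB₂
  obtain ⟨z₃, hz₃S, hz₃y, rfl, hz₃, -⟩ := exists_coloop_of_mem_r14CovPre hG hyG hyc hB₃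
  have hz₁₂ : z₁ ≠ z₂ := fun h => h₁₂ (by rw [h])
  have hz₁₃ : z₁ ≠ z₃ := fun h => h₁₃ (by rw [h])
  have hz₂₃ : z₂ ≠ z₃ := fun h => h₂₃ (by rw [h])
  set T := S \ {y, z₁, z₂, z₃} with hTdef
  have hT₃ : T ⊆ S.erase z₃ := by
    intro e he
    rw [hTdef, Finset.mem_sdiff] at he
    simp only [Finset.mem_insert, Finset.mem_singleton, not_or] at he
    exact Finset.mem_erase.2 ⟨he.2.2.2.2, he.1⟩
  have h3 := rkN_insert_coloop_eq (hSG.trans hGg) hz₃S hz₃ hT₃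
  have hT₂ : insert z₃ T ⊆ S.erase z₂ := by
    intro e he
    rw [Finset.mem_insert] at he
    rcases he with rfl | he
    · exact Finset.mem_erase.2 ⟨hz₂₃.symm, hz₃S⟩
    · rw [hTdef, Finset.mem_sdiff] at he
      simp only [Finset.mem_insert, Finset.mem_singleton, not_or] at he
      exact Finset.mem_erase.2 ⟨he.2.2.2.1, he.1⟩
  have h2 := rkN_insert_coloop_eq (hSG.trans hGg) hz₂S hz₂ hT₂
  have hT₁ : insert z₂ (insert z₃ T) ⊆ S.erase z₁ := by
    intro e he
    rw [Finset.mem_insert, Finset.mem_insert] at he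
    rcases he with rfl | rfl | he
    · exact Finset.mem_erase.2 ⟨hz₁₂.symm, hz₂S⟩
    · exact Finset.mem_erase.2 ⟨hz₁₃.symm, hz₃S⟩
    · rw [hTdef, Finset.mem_sdiff] at he
      simp only [Finset.mem_insert, Finset.mem_singleton, not_or] at he
      exact Finset.mem_erase.2 ⟨he.2.2.1, he.1⟩
  have h1 := rkN_insert_coloop_eq (hSG.trans hGg) hz₁S hz₁ hT₁
  have hTy : insert z₁ (insert z₂ (insert z₃ T)) ⊆ G.erase y := by
    intro e he
    rw [Finset.mem_insert, Finset.mem_insert, Finset.mem_insert] at he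
    rcases he with rfl | rfl | rfl | he
    · exact Finset.mem_erase.2 ⟨hz₁y, hSG hz₁S⟩
    · exact Finset.mem_erase.2 ⟨hz₂y, hSG hz₂S⟩
    · exact Finset.mem_erase.2 ⟨hz₃y, hSG hz₃S⟩
    · rw [hTdef, Finset.mem_sdiff] at he
      simp only [Finset.mem_insert, Finset.mem_singleton, not_or] at he
      exact Finset.mem_erase.2 ⟨he.2.1, hSG he.1⟩
  have h0 := rkN_insert_coloop_eq hGg hyG hyc hTy
  have hSeq : S = insert y (insert z₁ (insert z₂ (insert z₃ T))) := by
    ext e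
    simp only [hTdef, Finset.mem_insert, Finset.mem_sdiff, Finset.mem_singleton, not_or]
    constructor
    · intro he
      by_cases hey : e = y
      · exact Or.inl hey
      by_cases he₁ : e = z₁
      · exact Or.inr (Or.inl he₁)
      by_cases he₂ : e = z₂
      · exact Or.inr (Or.inr (Or.inl he₂))
      by_cases he₃ : e = z₃
      · exact Or.inr (Or.inr (Or.inr (Or.inl he₃)))
      exact Or.inr (Or.inr (Or.inr (Or.inr ⟨he, hey, he₁, he₂, he₃⟩)))
    · rintro (rfl | rfl | rfl | rfl | ⟨he, -⟩)
      · exact hyS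
      · exact hz₁S
      · exact hz₂S
      · exact hz₃S
      · exact he
  have h5 : rkN M (insert y (insert z₁ (insert z₂ (insert z₃ T)))) = 5 := by
    rw [← hSeq]
    exact rkN_eq_five_of_mem_shadowAt hS
  have hT1 : rkN M T ≤ 1 := by omega
  have hTg : T ⊆ gr M := by
    rw [hTdef]
    exact Finset.sdiff_subset.trans (hSG.trans hGg)
  have hTc := card_le_one_of_rkN_le_one hsimple hTg hT1
  have hSc : S.card ≤ T.card + 4 := by
    rw [hSeq]
    have := Finset.card_insert_le y (insert z₁ (insert z₂ (insert z₃ T)))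
    have := Finset.card_insert_le z₁ (insert z₂ (insert z₃ T))
    have := Finset.card_insert_le z₂ (insert z₃ T)
    have := Finset.card_insert_le z₃ T
    omega
  omega

end PercRepro.Shadow
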